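import Summits.AtomisticToContinuum.HydrodynamicLimit.Theses.OneFlightGossipEngine

/-!
# Sketch — crux-ideate stmt-AtomisticToContinuum-17701 (`SuperExponentialEnergyTails`),
# round 1, ideator 2

First-lemma signatures for the two crux idea cards of this seat:

* §A  card `euler-gauged-bobylev-summation`: the Euler-GAUGED energies
  `ê_i = ‖v_i − u(s,x_i)‖² / θ(s,x_i)`, the transfer target `GaugedGaussianMoment` (C⁺, a
  Nachtergaele–Yau II.1-type Gaussian moment in local thermal units under the TRUE law), the two
  one-sided contact inputs the Bobylev–Gamba–Panferov–Villani summation consumes at the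
  N-particle level (`GaugedPovznerCeiling`, `GaugedRateFloor`), and the kinematic fact that makes
  the RATE free: the flux-uniform angular (Povzner) constant is `2/(k+1)` and any impact law
  dominated by `C ×` uniform inherits `2C/(k+1)` (`angular_constant_uniform`,
  `angular_constant_dominated`, PROVED).
* §B  card `conditioned-equilibrium-transfer`: the exact window-by-window domination of an
  exponential tilt by the conditioned reference (`tilt_setLIntegral_le_of_windows`).
-/

noncomputable section

open MeasureTheory Filter Set Topology
open scoped ENNReal BigOperators

namespace Summit.AtomisticToContinuum.HydrodynamicLimit.Cruxes.SuperExponentialEnergyTails.IdeatorTwoR1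

open Literature.MathematicalPhysics.KineticTheory Literature.Analysis.FluidPDE

/-! ## §A  Euler-gauged energies, the gauged Gaussian moment, and the two contact inputs -/

/-- The **Euler-gauged energy** of a one-particle state `y = (x, v)` at macroscopic time `s`
with respect to velocity / temperature fields `(u, θ)` (intended: the classical hs-Euler solution
of the crux's hypotheses): `ê = ‖v − u(s,x)‖² / θ(s,x)` — kinetic energy in LOCAL thermal units.
Under a local Maxwellian with exactly these fields `ê/2 ∼ Γ(3/2, 1)` independently of `x`. -/
def gaugedEnergy (u : ℝ → T3 → V3) (θ : ℝ → T3 → ℝ) (s : ℝ) (y : T3 × V3) : ℝ :=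
  ‖y.2 - u s y.1‖ ^ 2 / θ s y.1

/-- **C⁺ — gauged Gaussian moment under the TRUE pre-shock law** (transfer target of the card
`euler-gauged-bobylev-summation`; it implies `SuperExponentialEnergyTails` with a Gaussian rate,
since `θ ≤ Θ̄`, `‖u‖ ≤ U` pre-shock and `r³ ≤ e^{-cK}·exp(a (r-U)²/Θ̄)` for `r > K ≥ K₀(c)`).
Same frame as the crux; `a, C, N₀` after `t`. -/
def GaugedGaussianMoment : Prop :=
  ∀ (a₀ θ₀ : T3 → ℝ) (u₀ : T3 → V3), Continuous a₀ → Continuous θ₀ → Continuous u₀ →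
    (∀ x, 0 < a₀ x) → (∀ x, 0 < θ₀ x) →
    ∃ σ₀ : ℝ, 0 < σ₀ ∧ ∀ σ : ℝ, 0 < σ → σ < σ₀ →
      ∀ (T : ℝ) (ρ θ : ℝ → T3 → ℝ) (u : ℝ → T3 → V3), IsHardSphereEulerSolution σ T ρ u θ →
        ∀ Φ : (N : ℕ) → HardSphereFlow (Torus.geometry (Fin 3)) (hsDiameter σ N) (N + 1),
          TendstoHydroFieldsAt (fun N => localGibbsLaw σ a₀ u₀ θ₀ N (Φ N)) Φ ρ u θ 0 →
            ∀ t ∈ Ico 0 T, ∃ a : ℝ, 0 < a ∧ ∃ C : ℝ, ∃ N₀ : ℕ, ∀ N : ℕ, N₀ ≤ N →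
              ∀ s ∈ Icc 0 t,
                ∫⁻ z, ENNReal.ofReal (((N : ℝ) + 1)⁻¹ * ∑ i : Fin (N + 1),
                    Real.exp (a * gaugedEnergy u θ s ((Φ N).flow s z i)))
                  ∂(localGibbsLaw σ a₀ u₀ θ₀ N (Φ N)) ≤ ENNReal.ofReal C

/-- **Input G2 — gauged Povzner (gain) ceiling, one-sided, `k`-uniform constant.** The expected
collision sum over `(s, s']` of the POST-collisional gauged energies to the power `k` is at most
`C · (2/(k+1)) · ν_N/(N+1)` times the same quantity computed on the Boltzmann (product) collision
measure of two INDEPENDENT copies of the true law: domination of the annealed marked contact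
measure — impact law AND pair law — by `C ×` (flux-uniform impact) ⊗ (product of gauged
marginals). `2/(k+1)` is the flux-uniform angular constant (`angular_constant_uniform`); the
content is that `C` does not depend on `k`. In Euler gauge the two-rare-participant obstruction
that refuted the ungauged product domination stmt-9218 (hot spot `θ₀ = 2 − ‖x‖`) is absent:
gauged pair statistics of a local Gibbs state are spatially homogeneous. -/
def GaugedPovznerCeiling : Prop :=
  ∀ (a₀ θ₀ : T3 → ℝ) (u₀ : T3 → V3), Continuous a₀ → Continuous θ₀ → Continuous u₀ →
    (∀ x, 0 < a₀ x) → (∀ x, 0 < θ₀ x) →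
    ∃ σ₀ : ℝ, 0 < σ₀ ∧ ∀ σ : ℝ, 0 < σ → σ < σ₀ →
      ∀ (T : ℝ) (ρ θ : ℝ → T3 → ℝ) (u : ℝ → T3 → V3), IsHardSphereEulerSolution σ T ρ u θ →
        ∀ Φ : (N : ℕ) → HardSphereFlow (Torus.geometry (Fin 3)) (hsDiameter σ N) (N + 1),
          TendstoHydroFieldsAt (fun N => localGibbsLaw σ a₀ u₀ θ₀ N (Φ N)) Φ ρ u θ 0 →
            ∀ t ∈ Ico 0 T, ∃ C : ℝ, 0 < C ∧ ∃ N₀ : ℕ, ∀ N : ℕ, N₀ ≤ N → ∀ k : ℕ, 2 ≤ k →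
              ∀ s s' : ℝ, 0 ≤ s → s ≤ s' → s' ≤ t →
                (let P := localGibbsLaw σ a₀ u₀ θ₀ N (Φ N)
                 let ê : ℝ → T3 × V3 → ℝ := gaugedEnergy u θ
                 ∫⁻ z, ENNReal.ofReal ((Φ N).collisionSum (Set.Ioc s s')
                     (fun c => ê c.time (c.fstPos, c.postVel.1) ^ k
                             + ê c.time (c.sndPos, c.postVel.2) ^ k) z) ∂P
                   ≤ ENNReal.ofReal (C * (2 / ((k : ℝ) + 1)) *
                        (σ ^ 2 * ((N : ℝ) + 1) ^ ((1 : ℝ) / 3) / ((N : ℝ) + 1))) *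
                     ∫⁻ r in Set.Ioc s s', ∫⁻ z, ∫⁻ z',
                       ENNReal.ofReal (∑ i : Fin (N + 1), ∑ j : Fin (N + 1),
                         (ê r ((Φ N).flow r z i) + ê r ((Φ N).flow r z' j)) ^ k *
                           (Real.sqrt (ê r ((Φ N).flow r z i)) +
                             Real.sqrt (ê r ((Φ N).flow r z' j)))) ∂P ∂P)

/-- **Input G3 — gauged rate FLOOR for energetic particles, one-sided, weight-uniform.** For every
nonnegative nondecreasing weight `g` vanishing below a threshold `E₀`, the expected collision sum
of `g(ê⁻)` over the two PRE-collisional partners in `(s, s']` is at least `c · ν_N` times the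
time-integral of `E Σ_i g(ê_i)(1 + √ê_i)` (Boltzmann's hard-sphere collision frequency of a
particle at gauged energy `ê`, up to the pre-shock bounds on `ρ, θ`, absorbed in `c`). The board's
`FastCollisionRateQuartic` (RF₂) is the instance `g = ê²·1{ê > E₀}`; here `c` is `g`-uniform,
which is what the all-orders summation needs. -/
def GaugedRateFloor : Prop :=
  ∀ (a₀ θ₀ : T3 → ℝ) (u₀ : T3 → V3), Continuous a₀ → Continuous θ₀ → Continuous u₀ →
    (∀ x, 0 < a₀ x) → (∀ x, 0 < θ₀ x) →
    ∃ σ₀ : ℝ, 0 < σ₀ ∧ ∀ σ : ℝ, 0 < σ → σ < σ₀ →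
      ∀ (T : ℝ) (ρ θ : ℝ → T3 → ℝ) (u : ℝ → T3 → V3), IsHardSphereEulerSolution σ T ρ u θ →
        ∀ Φ : (N : ℕ) → HardSphereFlow (Torus.geometry (Fin 3)) (hsDiameter σ N) (N + 1),
          TendstoHydroFieldsAt (fun N => localGibbsLaw σ a₀ u₀ θ₀ N (Φ N)) Φ ρ u θ 0 →
            ∀ t ∈ Ico 0 T, ∃ c : ℝ, 0 < c ∧ ∃ E₀ : ℝ, ∃ N₀ : ℕ, ∀ N : ℕ, N₀ ≤ N →
              ∀ s s' : ℝ, 0 ≤ s → s ≤ s' → s' ≤ t →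
                ∀ g : ℝ → ℝ, Monotone g → (∀ e, e ≤ E₀ → g e = 0) → (∀ e, 0 ≤ g e) →
                  (let P := localGibbsLaw σ a₀ u₀ θ₀ N (Φ N)
                   let ê : ℝ → T3 × V3 → ℝ := gaugedEnergy u θ
                   ENNReal.ofReal (c * (σ ^ 2 * ((N : ℝ) + 1) ^ ((1 : ℝ) / 3))) *
                       ∫⁻ r in Set.Ioc s s', ∫⁻ z, ENNReal.ofReal (∑ i : Fin (N + 1),
                         g (ê r ((Φ N).flow r z i)) * (1 + Real.sqrt (ê r ((Φ N).flow r z i)))) ∂P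
                     ≤ ∫⁻ z, ENNReal.ofReal ((Φ N).collisionSum (Set.Ioc s s')
                         (fun c => g (ê c.time (c.fstPos, c.preVel.1))
                                 + g (ê c.time (c.sndPos, c.preVel.2))) z) ∂P)

/-- **The rate is free (kinematics).** With the flux-uniform impact law and a partner at
relative rest the retained energy fraction `u = sin²ψ` is UNIFORM on `[0,1]`, so the Povzner
angular constant of order `k` is `∫₀¹ (uᵏ + (1−u)ᵏ) du = 2/(k+1) → 0` — the `k`-decay that
drives the Bobylev–GPV summation (GPV 2009, §2, `a_k`). -/
theorem angular_constant_uniform (k : ℕ) :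
    ∫ u in (0 : ℝ)..1, (u ^ k + (1 - u) ^ k) = 2 / ((k : ℝ) + 1) := by
  have h1 : ∫ u in (0 : ℝ)..1, u ^ k = 1 / ((k : ℝ) + 1) := by
    rw [integral_pow]
    simp
  have h2 : ∫ u in (0 : ℝ)..1, (1 - u) ^ k = 1 / ((k : ℝ) + 1) := by
    rw [intervalIntegral.integral_comp_sub_left (fun x : ℝ => x ^ k) 1]
    simp [integral_pow]
  rw [intervalIntegral.integral_add, h1, h2]
  · ring
  · exact (continuous_pow k).intervalIntegrable _ _
  · exact ((continuous_const.sub continuous_id).pow k).intervalIntegrable _ _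

/-- **Domination inherits the decay.** If the law `P` of the retained fraction has density at
most `C` with respect to Lebesgue measure on `[0,1]` (a ONE-SIDED bound, no equidistribution),
its Povzner constant of order `k` is at most `C · 2/(k+1)`: `k`-uniform domination of the
impact law makes the angular decay, hence the super-exponential RATE, free. -/
theorem angular_constant_dominated {P : Measure ℝ} {C : ℝ≥0∞}
    (hP : P ≤ C • (volume.restrict (Set.Icc (0 : ℝ) 1))) (k : ℕ) :
    ∫⁻ u, ENNReal.ofReal (u ^ k + (1 - u) ^ k) ∂P ≤ C * ENNReal.ofReal (2 / ((k : ℝ) + 1)) := by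
  have hcont : Continuous fun u : ℝ => u ^ k + (1 - u) ^ k := by fun_prop
  calc ∫⁻ u, ENNReal.ofReal (u ^ k + (1 - u) ^ k) ∂P
      ≤ ∫⁻ u, ENNReal.ofReal (u ^ k + (1 - u) ^ k) ∂(C • (volume.restrict (Set.Icc (0 : ℝ) 1))) :=
        lintegral_mono' hP le_rfl
    _ = C * ∫⁻ u in Set.Icc (0 : ℝ) 1, ENNReal.ofReal (u ^ k + (1 - u) ^ k) := by
        rw [lintegral_smul_measure, smul_eq_mul]
    _ = C * ENNReal.ofReal (∫ u in Set.Icc (0 : ℝ) 1, (u ^ k + (1 - u) ^ k)) := by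
        congr 1
        rw [← ofReal_integral_eq_lintegral_ofReal]
        · exact hcont.integrableOn_Icc
        · refine (ae_restrict_iff' measurableSet_Icc).2 (ae_of_all _ fun u hu => ?_)
          exact add_nonneg (pow_nonneg hu.1 k) (pow_nonneg (sub_nonneg.2 hu.2) k)
    _ = C * ENNReal.ofReal (2 / ((k : ℝ) + 1)) := by
        rw [integral_Icc_eq_integral_Ioc, ← intervalIntegral.integral_of_le zero_le_one,
          angular_constant_uniform]

/-! ## §B  Exponential tilts versus conditioned references (card `conditioned-equilibrium-transfer`) -/

/-- **Window-by-window transfer.** If the event `B` has conditional probability at most `η`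
under `μ` given every unit window `{n ≤ φ < n+1}` of the tilt exponent, then under the tilted
(un-normalised) weight `e^φ · μ` the mass of `B` is at most `e · η` times the total tilted mass.
With `μ` the global Gibbs law, `φ = log dλ₀/dμ` the local-Gibbs exponent and `B` a time-`s`
event pulled back by the flow, dividing by `Z = ∫ e^φ dμ` gives
`λ₀(B) ≤ e · sup_n μ(B | n ≤ φ < n+1)`: non-equilibrium probabilities are conditioned
EQUILIBRIUM probabilities up to the factor `e`, with no extensive loss. -/
theorem tilt_setLIntegral_le_of_windows {Ω : Type*} [MeasurableSpace Ω] (μ : Measure Ω)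
    {φ : Ω → ℝ} (hφ : Measurable φ) {B : Set Ω} (hB : MeasurableSet B) {η : ℝ≥0∞}
    (hwin : ∀ n : ℤ, μ (B ∩ φ ⁻¹' Set.Ico (n : ℝ) (n + 1)) ≤ η * μ (φ ⁻¹' Set.Ico (n : ℝ) (n + 1))) :
    ∫⁻ ω in B, ENNReal.ofReal (Real.exp (φ ω)) ∂μ
      ≤ ENNReal.ofReal (Real.exp 1) * η * ∫⁻ ω, ENNReal.ofReal (Real.exp (φ ω)) ∂μ := by
  classical
  have _hB := hB
  set f : Ω → ℝ≥0∞ := fun ω => ENNReal.ofReal (Real.exp (φ ω)) with hf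
  -- windows = fibres of the floor of the exponent
  set g : Ω → ℤ := fun ω => ⌊φ ω⌋ with hg
  have hgm : Measurable g := Int.measurable_floor.comp hφ
  have hWeq : ∀ n : ℤ, g ⁻¹' {n} = φ ⁻¹' Set.Ico (n : ℝ) (n + 1) := by
    intro n; ext ω
    simp only [Set.mem_preimage, Set.mem_singleton_iff, Set.mem_Ico, hg]
    exact Int.floor_eq_iff
  have hWm : ∀ n : ℤ, MeasurableSet (g ⁻¹' {n}) := fun n => hgm (measurableSet_singleton n)
  have hdisj : Pairwise (Function.onFun Disjoint fun n : ℤ => g ⁻¹' {n}) := pairwise_disjoint_fiber g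
  have hcover : (⋃ n : ℤ, g ⁻¹' {n}) = Set.univ := by
    ext ω; simp
  -- Step 1: decompose the tilted mass of B along the windows
  have hB_eq : B = ⋃ n : ℤ, (B ∩ g ⁻¹' {n}) := by
    rw [← Set.inter_iUnion, hcover, Set.inter_univ]
  have hdisjB : Pairwise (Function.onFun Disjoint fun n : ℤ => B ∩ g ⁻¹' {n}) :=
    hdisj.mono fun i j h => h.mono Set.inter_subset_right Set.inter_subset_right
  have step1 : ∫⁻ ω in B, f ω ∂μ = ∑' n : ℤ, ∫⁻ ω in B ∩ g ⁻¹' {n}, f ω ∂μ := by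
    conv_lhs => rw [hB_eq]
    exact lintegral_iUnion (fun n => hB.inter (hWm n)) hdisjB f
  -- Step 2: on a window the weight is pinned within a factor e
  have step2 : ∀ n : ℤ, ∫⁻ ω in B ∩ g ⁻¹' {n}, f ω ∂μ
      ≤ ENNReal.ofReal (Real.exp 1) * η * ∫⁻ ω in g ⁻¹' {n}, f ω ∂μ := by
    intro n
    have hup : ∀ ω ∈ B ∩ g ⁻¹' {n}, f ω ≤ ENNReal.ofReal (Real.exp ((n : ℝ) + 1)) := by
      intro ω hω
      have hω' : ω ∈ φ ⁻¹' Set.Ico (n : ℝ) (n + 1) := by rw [← hWeq n]; exact hω.2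
      exact ENNReal.ofReal_le_ofReal (Real.exp_le_exp.2 hω'.2.le)
    have hlow : ∀ ω ∈ g ⁻¹' {n}, ENNReal.ofReal (Real.exp (n : ℝ)) ≤ f ω := by
      intro ω hω
      have hω' : ω ∈ φ ⁻¹' Set.Ico (n : ℝ) (n + 1) := by rw [← hWeq n]; exact hω
      exact ENNReal.ofReal_le_ofReal (Real.exp_le_exp.2 hω'.1)
    have hwin' : μ (B ∩ g ⁻¹' {n}) ≤ η * μ (g ⁻¹' {n}) := by rw [hWeq n]; exact hwin n
    calc ∫⁻ ω in B ∩ g ⁻¹' {n}, f ω ∂μ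
        ≤ ∫⁻ ω in B ∩ g ⁻¹' {n}, ENNReal.ofReal (Real.exp ((n : ℝ) + 1)) ∂μ :=
          setLIntegral_mono' (hB.inter (hWm n)) hup
      _ = ENNReal.ofReal (Real.exp ((n : ℝ) + 1)) * μ (B ∩ g ⁻¹' {n}) := setLIntegral_const _ _
      _ ≤ ENNReal.ofReal (Real.exp ((n : ℝ) + 1)) * (η * μ (g ⁻¹' {n})) := by gcongr
      _ = ENNReal.ofReal (Real.exp 1) * η * (ENNReal.ofReal (Real.exp (n : ℝ)) * μ (g ⁻¹' {n})) := by
          rw [show ((n : ℝ) + 1) = 1 + (n : ℝ) by ring, Real.exp_add,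
            ENNReal.ofReal_mul (Real.exp_pos 1).le]
          ring
      _ ≤ ENNReal.ofReal (Real.exp 1) * η * ∫⁻ ω in g ⁻¹' {n}, f ω ∂μ := by
          gcongr
          calc ENNReal.ofReal (Real.exp (n : ℝ)) * μ (g ⁻¹' {n})
              = ∫⁻ _ω in g ⁻¹' {n}, ENNReal.ofReal (Real.exp (n : ℝ)) ∂μ :=
                (setLIntegral_const _ _).symm
            _ ≤ ∫⁻ ω in g ⁻¹' {n}, f ω ∂μ := setLIntegral_mono' (hWm n) hlow
  -- Step 3: resum the windows
  calc ∫⁻ ω in B, f ω ∂μ = ∑' n : ℤ, ∫⁻ ω in B ∩ g ⁻¹' {n}, f ω ∂μ := step1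
    _ ≤ ∑' n : ℤ, ENNReal.ofReal (Real.exp 1) * η * ∫⁻ ω in g ⁻¹' {n}, f ω ∂μ :=
        ENNReal.tsum_le_tsum step2
    _ = ENNReal.ofReal (Real.exp 1) * η * ∑' n : ℤ, ∫⁻ ω in g ⁻¹' {n}, f ω ∂μ := by
        rw [ENNReal.tsum_mul_left]
    _ = ENNReal.ofReal (Real.exp 1) * η * ∫⁻ ω, f ω ∂μ := by
        congr 1
        rw [← lintegral_iUnion hWm hdisj f, hcover, Measure.restrict_univ]

end Summit.AtomisticToContinuum.HydrodynamicLimit.Cruxes.SuperExponentialEnergyTails.IdeatorTwoR1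

end
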